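import Mathlib
import HarnessLib
import Summits.HubbardSuperconductivity.HubbardSuperconductivity.Theorems.KLProgrammeKLRegimeEngineSliceSpaceMomentOsc

/-!
# KL programme — K3 ENGINE child (`KLRegimeEngineV17F2`, stmt-HubbardSuperconductivity-20437), stub (b) weighted lines, cure (c-D) in the (K5′) MEAN-FREE
# ORGANISATION: the telescoped weighted rows along the mean-free chain in the TREE-WEIGHT currency `klScaleWt L M β j`

Cell `gate-hubbard-kl`, seat hubbard-kl-k3c3-p2 (g9); token #19 (K5′).  `…EngineSliceSpaceMomentOsc.rowSumWt_flowOsc_telescope_le` in the (E1-W) weight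
`klScaleWt L M β j` on the pair of leg positions (`S = Λ_j`, `s₀ = Λ_jβ/(2M)`, p3's `klScaleWt_pair_latticeLegPos_le`):

* **`rowSum_klScaleWt_flowOsc_telescope_le`** — `Σ_{Y′} ‖(SᵀC^{K̊_{m₀+d}}(μ′)S) Y Y′‖·klScaleWt_j{pos Y, pos Y′} ≤ [raw base rows at K̊_{m₀}, level μ′]
  + d · 8·Σ_{ω′} (Λ_j/ρ)·Π̂_j·√(24·2M·L²·N_s(ω,ω′))·2c₀K₁·c″U²` — the (K5′) SUM form the reduced-rate tower consumes (E1-WORD10 (W2)/(W3): #19 ≡ 1).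

Everything is proved; no definitions, no sorry.  Nothing asserts superconductivity.
-/

noncomputable section

namespace Summit.HubbardSuperconductivity.HubbardSuperconductivity.Theorems.EngineV8

set_option linter.dupNamespace false -- summit = problem name (single-conjunct summit), D-0017

open Real Finset Literature.MathematicalPhysics.QuantumLattice Literature.Probability.LatticeModels
open Summit.HubbardSuperconductivity.HubbardSuperconductivity.Theorems.DispersionFlow
open Summit.HubbardSuperconductivity.HubbardSuperconductivity.Theorems.KLRegimeSplit
open Summit.HubbardSuperconductivity.HubbardSuperconductivity.Theorems.TorusFourierL2
open Summit.HubbardSuperconductivity.HubbardSuperconductivity.Theorems.KLProgrammeLegKernels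

variable {L M : ℕ} [NeZero L] [NeZero M]

/-- **The telescoped weighted rows in `klScaleWt` currency: base + `d` equal `m`-free increments** (see the module docstring).
[cite: BenfattoGiulianiMastropietro2006, §2.7 (2.66)–(2.67), §3 (3.2)–(3.8)] -/
theorem rowSum_klScaleWt_flowOsc_telescope_le {β U μ μ' Λ Λ' c'' : ℝ} {R : RenConsts} {N : ℕ} (hβ : 0 < β) (hΛ : 0 < Λ) (hΛΛ' : Λ ≤ Λ')
    (hM : Λ' < π * (2 * M - 5) / β) (hR : ∀ j, 0 ≤ R.Gfr j) {m₀ d : ℕ} (hJ : ∀ m' < m₀ + d, FlowPieceJetsAt L M β U μ R m')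
    (hO : ∀ m' < m₀ + d, FlowPieceOscAt L M c'' β U μ m')
    {G₀ G₁ G₂ G₃ b₁ b₂ b₂' b₃ b₃' : ℝ} (hG₀ : G₀ = c'' * |U| * uPow 0 U) (hG₁ : G₁ = R.Gfr 1 * uPow 1 U) (hG₂ : G₂ = R.Gfr 2 * uPow 2 U)
    (hG₃ : G₃ = R.Gfr 3 * uPow 3 U) (hb₁ : b₁ = 4 + 4 / 3 * (R.Gfr 1 * uPow 1 U)) (hb₂ : b₂ = 16) (hb₂' : b₂' = R.Gfr 2 * uPow 2 U)
    (hb₃ : b₃ = 64) (hb₃' : b₃' = R.Gfr 3 * uPow 3 U / 3)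
    {B₁ B₂ B₃ B₄ : ℝ} (hB₁ : ∀ x, |deriv salmhoferCutoff x| ≤ B₁) (hB₂ : ∀ x, |deriv (deriv salmhoferCutoff) x| ≤ B₂)
    (hB₃ : ∀ x, |deriv (deriv (deriv salmhoferCutoff)) x| ≤ B₃) (hB₄ : ∀ x, |deriv (deriv (deriv (deriv salmhoferCutoff))) x| ≤ B₄)
    -- the sector multipliers: per pair, sup, support, time differences, space differences in scale form
    (F : Fin N → FreqMomentum L M → ℂ) (hF0 : ∀ ω ω' (q : TorusSite 1 (2 * M) × TorusSite 2 L), ‖F ω (⟨(q.1 0).val, ZMod.val_lt (q.1 0)⟩, q.2) * F ω' (⟨(q.1 0).val, ZMod.val_lt (q.1 0)⟩, q.2)‖ ≤ 1)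
    {Ns : Fin N → Fin N → ℕ} (hsupp : ∀ ω ω', (univ.filter fun q : TorusSite 1 (2 * M) × TorusSite 2 L => F ω (⟨(q.1 0).val, ZMod.val_lt (q.1 0)⟩, q.2) * F ω' (⟨(q.1 0).val, ZMod.val_lt (q.1 0)⟩, q.2) ≠ 0).card ≤ Ns ω ω')
    (v : Fin N → Fin 2 → ℤ) (hv : ∀ ω, v ω ≠ 0)
    {at₁ at₂ at₃ : ℝ} (hat₁ : 0 ≤ at₁) (hat₂ : 0 ≤ at₂) (hat₃ : 0 ≤ at₃)
    (hMt₁ : ∀ ω ω' q, ‖fwdDiff ((fun _ : Fin 1 => (1 : ZMod (2 * M))), (0 : TorusSite 2 L)) (fun q : TorusSite 1 (2 * M) × TorusSite 2 L => F ω (⟨(q.1 0).val, ZMod.val_lt (q.1 0)⟩, q.2) * F ω' (⟨(q.1 0).val, ZMod.val_lt (q.1 0)⟩, q.2)) q‖ ≤ at₁)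
    (hMt₂ : ∀ ω ω' q, ‖(fwdDiff ((fun _ : Fin 1 => (1 : ZMod (2 * M))), (0 : TorusSite 2 L)))^[2] (fun q : TorusSite 1 (2 * M) × TorusSite 2 L => F ω (⟨(q.1 0).val, ZMod.val_lt (q.1 0)⟩, q.2) * F ω' (⟨(q.1 0).val, ZMod.val_lt (q.1 0)⟩, q.2)) q‖ ≤ at₂)
    (hMt₃ : ∀ ω ω' q, ‖(fwdDiff ((fun _ : Fin 1 => (1 : ZMod (2 * M))), (0 : TorusSite 2 L)))^[3] (fun q : TorusSite 1 (2 * M) × TorusSite 2 L => F ω (⟨(q.1 0).val, ZMod.val_lt (q.1 0)⟩, q.2) * F ω' (⟨(q.1 0).val, ZMod.val_lt (q.1 0)⟩, q.2)) q‖ ≤ at₃)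
    {α₁ α₂ α₃ : ℝ} (hα₁ : 0 ≤ α₁) (hα₂ : 0 ≤ α₂) (hα₃ : 0 ≤ α₃)
    (hMe₁ : ∀ ω ω' q (i : Fin 2), ‖fwdDiff ((0 : TorusSite 1 (2 * M)), (Pi.single i (1 : ZMod L) : TorusSite 2 L)) (fun q : TorusSite 1 (2 * M) × TorusSite 2 L => F ω (⟨(q.1 0).val, ZMod.val_lt (q.1 0)⟩, q.2) * F ω' (⟨(q.1 0).val, ZMod.val_lt (q.1 0)⟩, q.2)) q‖ ≤
      α₁ * ‖(WithLp.toLp 2 (fun j => 2 * π / L * ((Pi.single i (1 : ℤ) : Fin 2 → ℤ) j : ℝ)) : EuclideanSpace ℝ (Fin 2))‖)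
    (hMe₂ : ∀ ω ω' q (i : Fin 2), ‖(fwdDiff ((0 : TorusSite 1 (2 * M)), (Pi.single i (1 : ZMod L) : TorusSite 2 L)))^[2] (fun q : TorusSite 1 (2 * M) × TorusSite 2 L => F ω (⟨(q.1 0).val, ZMod.val_lt (q.1 0)⟩, q.2) * F ω' (⟨(q.1 0).val, ZMod.val_lt (q.1 0)⟩, q.2)) q‖ ≤
      α₂ * ‖(WithLp.toLp 2 (fun j => 2 * π / L * ((Pi.single i (1 : ℤ) : Fin 2 → ℤ) j : ℝ)) : EuclideanSpace ℝ (Fin 2))‖ ^ 2)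
    (hMe₃ : ∀ ω ω' q (i : Fin 2), ‖(fwdDiff ((0 : TorusSite 1 (2 * M)), (Pi.single i (1 : ZMod L) : TorusSite 2 L)))^[3] (fun q : TorusSite 1 (2 * M) × TorusSite 2 L => F ω (⟨(q.1 0).val, ZMod.val_lt (q.1 0)⟩, q.2) * F ω' (⟨(q.1 0).val, ZMod.val_lt (q.1 0)⟩, q.2)) q‖ ≤
      α₃ * ‖(WithLp.toLp 2 (fun j => 2 * π / L * ((Pi.single i (1 : ℤ) : Fin 2 → ℤ) j : ℝ)) : EuclideanSpace ℝ (Fin 2))‖ ^ 3)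
    (hMn₁ : ∀ ω ω' q, ‖fwdDiff ((0 : TorusSite 1 (2 * M)), (fun j => ((![-(v ω) 1, (v ω) 0] j : ℤ) : ZMod L))) (fun q : TorusSite 1 (2 * M) × TorusSite 2 L => F ω (⟨(q.1 0).val, ZMod.val_lt (q.1 0)⟩, q.2) * F ω' (⟨(q.1 0).val, ZMod.val_lt (q.1 0)⟩, q.2)) q‖ ≤
      α₁ * ‖(WithLp.toLp 2 (fun j => 2 * π / L * ((![-(v ω) 1, (v ω) 0] : Fin 2 → ℤ) j : ℝ)) : EuclideanSpace ℝ (Fin 2))‖)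
    (hMn₂ : ∀ ω ω' q, ‖(fwdDiff ((0 : TorusSite 1 (2 * M)), (fun j => ((![-(v ω) 1, (v ω) 0] j : ℤ) : ZMod L))))^[2] (fun q : TorusSite 1 (2 * M) × TorusSite 2 L => F ω (⟨(q.1 0).val, ZMod.val_lt (q.1 0)⟩, q.2) * F ω' (⟨(q.1 0).val, ZMod.val_lt (q.1 0)⟩, q.2)) q‖ ≤
      α₂ * ‖(WithLp.toLp 2 (fun j => 2 * π / L * ((![-(v ω) 1, (v ω) 0] : Fin 2 → ℤ) j : ℝ)) : EuclideanSpace ℝ (Fin 2))‖ ^ 2)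
    (hMn₃ : ∀ ω ω' q, ‖(fwdDiff ((0 : TorusSite 1 (2 * M)), (fun j => ((![-(v ω) 1, (v ω) 0] j : ℤ) : ZMod L))))^[3] (fun q : TorusSite 1 (2 * M) × TorusSite 2 L => F ω (⟨(q.1 0).val, ZMod.val_lt (q.1 0)⟩, q.2) * F ω' (⟨(q.1 0).val, ZMod.val_lt (q.1 0)⟩, q.2)) q‖ ≤
      α₃ * ‖(WithLp.toLp 2 (fun j => 2 * π / L * ((![-(v ω) 1, (v ω) 0] : Fin 2 → ℤ) j : ℝ)) : EuclideanSpace ℝ (Fin 2))‖ ^ 3)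
    (hMv₁ : ∀ ω ω' q, ‖fwdDiff ((0 : TorusSite 1 (2 * M)), (fun j => (((v ω) j : ℤ) : ZMod L))) (fun q : TorusSite 1 (2 * M) × TorusSite 2 L => F ω (⟨(q.1 0).val, ZMod.val_lt (q.1 0)⟩, q.2) * F ω' (⟨(q.1 0).val, ZMod.val_lt (q.1 0)⟩, q.2)) q‖ ≤
      α₁ * ‖(WithLp.toLp 2 (fun j => 2 * π / L * ((v ω) j : ℝ)) : EuclideanSpace ℝ (Fin 2))‖)
    (hMv₂ : ∀ ω ω' q, ‖(fwdDiff ((0 : TorusSite 1 (2 * M)), (fun j => (((v ω) j : ℤ) : ZMod L))))^[2] (fun q : TorusSite 1 (2 * M) × TorusSite 2 L => F ω (⟨(q.1 0).val, ZMod.val_lt (q.1 0)⟩, q.2) * F ω' (⟨(q.1 0).val, ZMod.val_lt (q.1 0)⟩, q.2)) q‖ ≤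
      α₂ * ‖(WithLp.toLp 2 (fun j => 2 * π / L * ((v ω) j : ℝ)) : EuclideanSpace ℝ (Fin 2))‖ ^ 2)
    (hMv₃ : ∀ ω ω' q, ‖(fwdDiff ((0 : TorusSite 1 (2 * M)), (fun j => (((v ω) j : ℤ) : ZMod L))))^[3] (fun q : TorusSite 1 (2 * M) × TorusSite 2 L => F ω (⟨(q.1 0).val, ZMod.val_lt (q.1 0)⟩, q.2) * F ω' (⟨(q.1 0).val, ZMod.val_lt (q.1 0)⟩, q.2)) q‖ ≤
      α₃ * ‖(WithLp.toLp 2 (fun j => 2 * π / L * ((v ω) j : ℝ)) : EuclideanSpace ℝ (Fin 2))‖ ^ 3)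
    -- the level `j` (weight rates `Λ_jβ/(2M), Λ_j`), the piece rates `ρ, ρ₃`, the time condition, the thresholds AT `m₀`, the rate conditions
    (j : ℕ) {ρ ρ₃ k₁ k₂ k₃ k₄ : ℝ} (hρ : 0 < ρ) (hρ₃ : 0 < ρ₃) (hSρ : ρ ≤ klScale klE0 j * (4 : ℝ) ^ m₀)
    (hk₁ : k₁ = (16 * B₁ + 16) / Λ ^ 2) (hk₂ : k₂ = (32 * B₂ + 144 * B₁ + 128) / Λ ^ 3)
    (hk₃ : k₃ = (64 * B₃ + 480 * B₂ + 1728 * B₁ + 1536) / Λ ^ 4)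
    (hk₄ : k₄ = (128 * B₄ + 1408 * B₃ + 7776 * B₂ + 27648 * B₁ + 24576) / Λ ^ 5)
    (ht : (2 * π / β) ^ 3 * ((128 * B₄ + 1216 * B₃ + 6912 * B₂ + 26112 * B₁ + 24576) * (β * (L : ℝ) ^ 2) / Λ ^ 5) +
          3 * (at₁ * ((2 * π / β) ^ 2 * ((64 * B₃ + 416 * B₂ + 1600 * B₁ + 1536) * (β * (L : ℝ) ^ 2) / Λ ^ 4))) +
          3 * (at₂ * ((2 * π / β) * ((32 * B₂ + 128 * B₁ + 128) * (β * (L : ℝ) ^ 2) / Λ ^ 3))) + at₃ * ((16 * B₁ + 16) * (β * (L : ℝ) ^ 2) / Λ ^ 2) ≤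
      2 * ((16 * B₁ + 16) * (β * (L : ℝ) ^ 2) / Λ ^ 2) * (4 / (klScale klE0 j * β / (2 * M) * (2 * M : ℕ))) ^ 3)
    (hX1 : 3 * (3 * G₁ * k₂ * b₂' + 3 * G₂ * k₁ * α₁ + 3 * G₂ * k₂ * b₁) ≤ k₁ * G₃ * (4 : ℝ) ^ m₀)
    (hX2 : 3 * (3 * G₀ * k₂ * α₁ * b₂' + 3 * G₀ * k₃ * b₁ * b₂' + 6 * G₁ * k₂ * α₁ * b₁ + 3 * G₁ * k₃ * b₁ ^ 2 + G₀ * G₃ * k₂ + G₀ * k₂ * b₃' + 3 * G₁ * G₂ * k₂ + 3 * G₁ * k₁ * α₂ + 3 * G₁ * k₂ * b₂) ≤ k₁ * G₃ * ((4 : ℝ) ^ m₀) ^ 2)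
    (hX3 : 3 * ((3 * G₀ * k₃ * α₁ * b₁ ^ 2 + G₀ * k₄ * b₁ ^ 3 + 3 * G₀ * G₁ * k₃ * b₂' + 3 * G₀ * G₂ * k₂ * α₁ + 3 * G₀ * G₂ * k₃ * b₁ + 3 * G₀ * k₂ * α₁ * b₂ + 3 * G₀ * k₂ * α₂ * b₁ + 3 * G₀ * k₃ * b₁ * b₂ + 3 * G₁ ^ 2 * k₂ * α₁ + 3 * G₁ ^ 2 * k₃ * b₁ + G₀ * k₁ * α₃ + G₀ * k₂ * b₃) + (6 * G₀ * G₁ * k₃ * α₁ * b₁ + 3 * G₀ * G₁ * k₄ * b₁ ^ 2 + 3 * G₀ * G₁ * G₂ * k₃ + 3 * G₀ * G₁ * k₂ * α₂ + 3 * G₀ * G₁ * k₃ * b₂ + G₁ ^ 3 * k₃) + (3 * G₀ * G₁ ^ 2 * k₃ * α₁ + 3 * G₀ * G₁ ^ 2 * k₄ * b₁) + (G₀ * G₁ ^ 3 * k₄)) ≤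
      k₁ * G₃ * ((4 : ℝ) ^ m₀) ^ 3)
    (hY1 : 2 * (G₀ * k₂ * b₂' + 2 * G₁ * k₁ * α₁ + 2 * G₁ * k₂ * b₁) ≤ k₁ * G₂ * (4 : ℝ) ^ m₀)
    (hY2 : 2 * ((2 * G₀ * k₂ * α₁ * b₁ + G₀ * k₃ * b₁ ^ 2 + G₀ * G₂ * k₂ + G₀ * k₁ * α₂ + G₀ * k₂ * b₂ + G₁ ^ 2 * k₂) + (2 * G₀ * G₁ * k₂ * α₁ + 2 * G₀ * G₁ * k₃ * b₁) + (G₀ * G₁ ^ 2 * k₃)) ≤ k₁ * G₂ * ((4 : ℝ) ^ m₀) ^ 2)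
    (hrate₃ : G₃ * ρ ^ 3 ≤ (2 / π) ^ 3 * G₀) (hrate₂ : G₂ * ρ₃ ^ 2 ≤ (2 / π) ^ 2 * G₀)
    (Y : SpaceTimeIdx L M × SectorLeg N) :
    ∑ Y' : SpaceTimeIdx L M × SectorLeg N,
        ‖((sectorSubMatrix L M β F).transpose * hubbardCovSliceCT L M β μ' 0 (fsub (klFlowFrameU L M β U μ (m₀ + d)) (symInterp L fun _ => -(∑ m' ∈ range (m₀ + d), klAngularMean (klLocalPart L M β U μ (klFlowFrameU L M β U μ m') m')))) Λ Λ' *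
            sectorSubMatrix L M β F) Y Y'‖ *
          klScaleWt L M β j {latticeLegPos (2 * (2 * M)) Y, latticeLegPos (2 * (2 * M)) Y'} ≤
      8 * ∑ ω' : Fin N, ∑ z : TorusSite 1 (2 * M) × TorusSite 2 L, (1 + klScale klE0 j * β / (2 * M) * |(((z.1 0).valMinAbs : ℤ) : ℝ)| + klScale klE0 j * |(((z.2 0).valMinAbs : ℤ) : ℝ)| + klScale klE0 j * |(((z.2 1).valMinAbs : ℤ) : ℝ)|) *
        ‖∑ q : TorusSite 1 (2 * M) × TorusSite 2 L, (torusChar q.1 z.1 * torusChar q.2 z.2) •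
          ((((1 / (β * (L : ℝ) ^ 2) : ℝ) : ℂ) ^ 2 *
            (F Y.2.1.1 (⟨(q.1 0).val, ZMod.val_lt (q.1 0)⟩, q.2) * F ω' (⟨(q.1 0).val, ZMod.val_lt (q.1 0)⟩, q.2) *
              sliceSymbolFnXi (β * (L : ℝ) ^ 2) 0 Λ Λ' (matsubaraFreq β M ⟨(q.1 0).val, ZMod.val_lt (q.1 0)⟩)
                (nambuXiCT L μ' ((fsub (klFlowFrameU L M β U μ m₀) (symInterp L fun _ => -(∑ m' ∈ range m₀, klAngularMean (klLocalPart L M β U μ (klFlowFrameU L M β U μ m') m'))))) q.2))))‖ +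
      (d : ℝ) * (8 * ∑ ω' : Fin N, klScale klE0 j / ρ * Real.sqrt (524288 * (1 / (klScale klE0 j * β / (2 * M)) + 1) * ((1 + 4 * Real.sqrt 2) ^ 2 * ((2 * Real.sqrt 2 / ρ + 2) * (2 * Real.sqrt 2 / ρ₃ + 2)) + (1 / ρ + 1) ^ 2)) *
        Real.sqrt (24 * (2 * M : ℕ) * (L : ℝ) ^ 2 * Ns Y.2.1.1 ω') * (2 * ((1 / (β * (L : ℝ) ^ 2)) ^ 2 * ((16 * B₁ + 16) * (β * (L : ℝ) ^ 2) / Λ ^ 2 * G₀)))) := by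
  classical
  have hΛj : 0 < klScale klE0 j := klth_klScale_pos j
  have hM0 : (0 : ℝ) < M := by exact_mod_cast Nat.pos_of_ne_zero (NeZero.ne M)
  have hs₀ : 0 < klScale klE0 j * β / (2 * M) := by positivity
  have hmain := rowSumWt_flowOsc_telescope_le (L := L) (M := M) (μ' := μ') hβ hΛ hΛΛ' hM hR hJ hO hG₀ hG₁ hG₂ hG₃ hb₁ hb₂ hb₂' hb₃ hb₃' hB₁ hB₂ hB₃ hB₄ F hF0 hsupp v hv
    hat₁ hat₂ hat₃ hMt₁ hMt₂ hMt₃ hα₁ hα₂ hα₃ hMe₁ hMe₂ hMe₃ hMn₁ hMn₂ hMn₃ hMv₁ hMv₂ hMv₃ hs₀ hρ hρ₃ hSρ hk₁ hk₂ hk₃ hk₄ ht hX1 hX2 hX3 hY1 hY2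
    hrate₃ hrate₂ Y
  refine le_trans (Finset.sum_le_sum fun Y' _ => mul_le_mul_of_nonneg_left ?_ (norm_nonneg _)) hmain
  exact klScaleWt_pair_latticeLegPos_le (L := L) (M := M) hβ.le j Y Y'

end Summit.HubbardSuperconductivity.HubbardSuperconductivity.Theorems.EngineV8

end
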